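import Mathlib
import Summits.CriticalPhenomena.SAWScalingLimit.Theorems.SAWDefectDecoherenceObservableToSLERNestedTransferCells
import Summits.CriticalPhenomena.SAWScalingLimit.Theorems.SAWDefectDecoherenceObservableToSLERGateTransferPerMesh

/-!
# Nested transfer, assembly 3: the per-mesh estimate over tame nested families

Support file for the stub `stub_nestedTransfer` (the nested transfer
`GateDecomposition → NestedRenewal → CarvedToSLEN → HexTight → FullIdentification`) of the line
`bridge-gate-renewal` (reshape r3: nested tame gate families) for the crux
`Summit.CriticalPhenomena.SAWScalingLimit.Theses.SAWDefectDecoherence.ObservableToSLER`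
(item `stmt-CriticalPhenomena-14005`).  Port of
`Theorems/SAWDefectDecoherenceObservableToSLERGateTransferPerMesh.lean` to the nested vocabulary
(`productCellN`, `GateLabel.cellN`, removed sets `S n ∪ T n'`):

* `dist_curve_midCurve_le_N` — the curve of a walk of a product cell is within `C` of its middle
  piece (`dist_mk_polyline_append_le`);
* `abs_integral_sub_le_of_productCellN` (registered sub-goal `stub_perMeshEstimateN`) — at a mesh
  where the critical SAW law is a probability measure and every walk lies in a product cell over
  the families `S`, `T`, the `NestedRenewal` and `CarvedToSLEN` bounds give
  `|∫ f ∘ curve dP_δ - ∫ f dν| ≤ K C + ε (1 + 4 ‖f‖)` for `K`-Lipschitz bounded `f` (exact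
  factorisation per cell `setIntegral_cyl_midCurve_law`, Lipschitz comparison, summation over the
  cells).
-/

noncomputable section

open scoped BigOperators Topology NNReal ENNReal Classical BoundedContinuousFunction unitInterval
open Filter Set MeasureTheory Metric

namespace Summit.CriticalPhenomena.SAWScalingLimit.Theorems.ObservableToSLER.NestedGate

open Literature.Probability.LatticeModels (HexVertex hexGraph hexCenter triZeta Site polyline)
open Literature.Probability.RandomPlanarGeometry
open Literature.Probability.RandomPlanarGeometry.SAW
open Summit.CriticalPhenomena.SAWScalingLimit.Theorems.ObservableToSLE.Negative
  (finite_hexDomainSAW)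
open Summit.CriticalPhenomena.SAWScalingLimit.Theorems.ObservableToSLER.BridgeGate

section PerMesh

variable {Ω : Set ℂ} {δ ρ R : ℝ} {S T : ℕ → Set HexVertex} {a b : HexVertex}

/-- **Distance between a walk of a product cell and its middle piece.** -/
theorem dist_curve_midCurve_le_N {C : ℝ} (hC : 0 ≤ C) {κ : GateLabel} {γ₀ γ : HexDomainSAW Ω δ a b}
    (hcs : γ₀ ∈ productCellN Ω δ ρ R S T a b C) (h₀ : γ₀.walk.support ∈ κ.cellN Ω δ ρ R S T a b)
    (hγ : γ ∈ κ.cyl (S κ.n) (T κ.n') Ω δ a b) :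
    dist γ.curve (κ.midCurve δ γ) ≤ C := by
  obtain ⟨mid, hh, hl, -, hsupp⟩ := hγ
  obtain ⟨-, -, -, -, -, -, -, hd1, hd2⟩ := hcs κ.n κ.m κ.p κ.q κ.n' κ.m' κ.p' κ.q' h₀.1 h₀.2.1
  rw [h₀.2.2.1] at hd1
  rw [h₀.2.2.2] at hd2
  have hmid : mid ≠ [] := by rintro rfl; simp at hh
  set e : HexVertex → ℂ := fun v => (δ : ℂ) * hexCenter v with he
  have hM : mid.map e ≠ [] := by simpa using hmid
  rw [GateLabel.midCurve, hsupp, midList_append, curve_eq_polyClass, hsupp, polyClass, polyClass,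
    List.map_append, List.map_append]
  refine dist_mk_polyline_append_le hM hC (fun x hx => ?_) (fun x hx => ?_)
  · obtain ⟨v, hv, rfl⟩ := List.mem_map.1 hx
    have hq : (mid.map e).head hM = e κ.q := by
      rw [List.head_map, (List.head_eq_iff_head?_eq_some hmid).2 hh]
    rw [hq]
    exact hd1 v hv
  · obtain ⟨v, hv, rfl⟩ := List.mem_map.1 hx
    have hq' : (mid.map e).getLast hM = e κ.q' := by
      rw [List.getLast_map, (List.getLast_eq_iff_getLast?_eq_some hmid).2 hl]
    rw [hq']
    exact hd2 v hv

/-- **THE PER-MESH ESTIMATE OVER TAME NESTED FAMILIES.**  At a mesh where the critical SAW law is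
a probability measure and every walk lies in a product cell over the families `S`, `T`: if the
walks without good renewal at both ends have mass `≤ ε` (`NestedRenewal`) and the walks whose first
good gates carve a middle law more than `ε`-off from `ν` against `f` have mass `≤ ε`
(`CarvedToSLEN`), then for a `K`-Lipschitz bounded `f` the law of the curve is
`K C + ε (1 + 4 ‖f‖)`-close to `ν` against `f`. -/
theorem abs_integral_sub_le_of_productCellN (hΩ : Bornology.IsBounded Ω) (hδ : 0 < δ) {C : ℝ}
    (hC : 0 ≤ C)
    (hGD : ∀ (p q p' q' : HexVertex) (S T : Set HexVertex) (l₁ l₂ : List HexVertex)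
      (B : Set (List HexVertex)),
      Disjoint S T →
      (∃ w₁ : (hexDomainGraph Ω δ).Walk a p, w₁.IsPath ∧ w₁.support = l₁ ∧ ∀ v ∈ l₁, v ∈ S) →
      (∃ w₂ : (hexDomainGraph Ω δ).Walk p' b, w₂.IsPath ∧ w₂.support = l₂ ∧ ∀ v ∈ l₂, v ∈ T) →
      (hexDomainGraph Ω δ).Adj p q → (hexDomainGraph Ω δ).Adj q' p' →
      hexSAWWeight Ω δ a b
          {γ | ∃ mid ∈ B, mid.head? = some q ∧ mid.getLast? = some q' ∧
            (∀ v ∈ mid, v ∉ S ∧ v ∉ T) ∧ γ.walk.support = l₁ ++ mid ++ l₂} =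
        ENNReal.ofReal (hexCriticalFugacity ^ (l₁.length + l₂.length)) *
          hexSAWWeight Ω δ q q'
            {γ | γ.walk.support ∈ B ∧ ∀ v ∈ γ.walk.support, v ∉ S ∧ v ∉ T})
    (hcs : ∀ γ₀ : HexDomainSAW Ω δ a b, γ₀ ∈ productCellN Ω δ ρ R S T a b C)
    [IsProbabilityMeasure (hexSAWLaw Ω δ a b)]
    (ν : Measure (CurveClass ℂ)) [IsProbabilityMeasure ν] (f : CurveClass ℂ →ᵇ ℝ) {K : ℝ≥0}
    (hf : LipschitzWith K f) {ε : ℝ} (hε : 0 ≤ ε)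
    (hRA : (hexSAWLaw Ω δ a b).real {γ | ¬ (GoodRenewalAtN Ω δ ρ R S a γ.walk.support ∧
      GoodRenewalAtN Ω δ ρ R T b γ.walk.support.reverse)} ≤ ε)
    (hCTS : (hexSAWLaw Ω δ a b).real
      {γ | ∃ (n m : ℕ) (p q : HexVertex) (n' m' : ℕ) (p' q' : HexVertex),
        IsFirstGoodGateN Ω δ ρ R S a γ.walk.support n m p q ∧
        IsFirstGoodGateN Ω δ ρ R T b γ.walk.support.reverse n' m' p' q' ∧
        ε < |(∫ ξ, f ξ.curve ∂(carvedLaw Ω δ (S n ∪ T n') q q')) - ∫ x, f x ∂ν|} ≤ ε) :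
    |∫ γ, f γ.curve ∂(hexSAWLaw Ω δ a b) - ∫ x, f x ∂ν| ≤ K * C + ε * (1 + 4 * ‖f‖) := by
  classical
  haveI hfinT : ∀ u v : HexVertex, Finite (HexDomainSAW Ω δ u v) :=
    fun u v => finite_hexDomainSAW hΩ hδ.ne' u v
  haveI := Fintype.ofFinite (HexDomainSAW Ω δ a b)
  set P := hexSAWLaw Ω δ a b with hP
  -- the good event and its cells
  set G : Set (HexDomainSAW Ω δ a b) := {γ | GoodRenewalAtN Ω δ ρ R S a γ.walk.support ∧
    GoodRenewalAtN Ω δ ρ R T b γ.walk.support.reverse} with hGdef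
  have hlab : ∀ γ : HexDomainSAW Ω δ a b, γ ∈ G → ∃ κ : GateLabel,
      γ.walk.support ∈ κ.cellN Ω δ ρ R S T a b := fun γ h => exists_mem_cellN h.1 h.2
  let κ₀ : GateLabel := ⟨0, 0, a, a, 0, 0, a, a, [], []⟩
  let lab : HexDomainSAW Ω δ a b → GateLabel := fun γ =>
    if h : γ ∈ G then (hlab γ h).choose else κ₀
  have hlab_spec : ∀ γ ∈ G, γ.walk.support ∈ (lab γ).cellN Ω δ ρ R S T a b := by
    intro γ h
    simp only [lab, dif_pos h]
    exact (hlab γ h).choose_spec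
  set Λ : Finset GateLabel := Finset.univ.image lab with hΛ
  set Cell : GateLabel → Set (HexDomainSAW Ω δ a b) :=
    fun κ => {γ | γ.walk.support ∈ κ.cellN Ω δ ρ R S T a b} with hCell
  have hCellG : ∀ κ, Cell κ ⊆ G := fun κ γ hγ => ⟨hγ.1.goodRenewalAtN, hγ.2.1.goodRenewalAtN⟩
  have hGU : G = ⋃ κ ∈ Λ, Cell κ := by
    ext γ
    simp only [Set.mem_iUnion, exists_prop]
    constructor
    · intro h
      exact ⟨lab γ, Finset.mem_image_of_mem _ (Finset.mem_univ _), hlab_spec γ h⟩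
    · rintro ⟨κ, -, hκ⟩
      exact hCellG κ hκ
  have hdisj : (Λ : Set GateLabel).PairwiseDisjoint Cell := by
    intro κ _ κ' _ hne
    refine Set.disjoint_left.2 fun γ h h' => hne ?_
    exact GateLabel.eq_of_mem_cellN h h'
  have hmeas : ∀ s : Set (HexDomainSAW Ω δ a b), MeasurableSet s :=
    fun _ => MeasurableSpace.measurableSet_top
  -- carved integrals and the per-cell estimate
  set J : GateLabel → ℝ := fun κ =>
    ∫ ξ, f ξ.curve ∂(carvedLaw Ω δ (S κ.n ∪ T κ.n') κ.q κ.q') with hJ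
  set νf : ℝ := ∫ x, f x ∂ν with hνf
  have hνf_le : |νf| ≤ ‖f‖ := by
    have := f.norm_integral_le_norm ν
    rwa [Real.norm_eq_abs] at this
  have hJ_le : ∀ κ, |J κ| ≤ ‖f‖ := fun κ => abs_integral_carvedLaw_le f
  have hper : ∀ κ, |∫ γ in Cell κ, f γ.curve ∂P - P.real (Cell κ) * J κ| ≤
      K * C * P.real (Cell κ) := by
    intro κ
    by_cases hne : (Cell κ).Nonempty
    · obtain ⟨γ₀, hγ₀⟩ := hne
      obtain ⟨hST, hw₁, hw₂, hpq, hqp, -, -, -, -⟩ :=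
        hcs γ₀ κ.n κ.m κ.p κ.q κ.n' κ.m' κ.p' κ.q' hγ₀.1 hγ₀.2.1
      have hcyl : Cell κ = κ.cyl (S κ.n) (T κ.n') Ω δ a b := by
        ext γ
        constructor
        · intro h
          have hlen := (hcs γ κ.n κ.m κ.p κ.q κ.n' κ.m' κ.p' κ.q' h.1 h.2.1).2.2.2.2.2.1
          exact mem_cyl_of_mem_cellN h hlen
        · intro h
          exact mem_cellN_of_mem_cyl (hcs γ₀) hγ₀ h
      have hGDκ : ∀ B : Set (List HexVertex),
          hexSAWWeight Ω δ a b
            {γ | ∃ mid ∈ B, mid.head? = some κ.q ∧ mid.getLast? = some κ.q' ∧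
              (∀ v ∈ mid, v ∉ S κ.n ∧ v ∉ T κ.n') ∧
              γ.walk.support = κ.l₁ ++ mid ++ κ.l₂} =
          ENNReal.ofReal (hexCriticalFugacity ^ (κ.l₁.length + κ.l₂.length)) *
            hexSAWWeight Ω δ κ.q κ.q'
              {γ | γ.walk.support ∈ B ∧ ∀ v ∈ γ.walk.support, v ∉ S κ.n ∧ v ∉ T κ.n'} := by
        intro B
        rw [hγ₀.2.2.1] at hw₁
        rw [hγ₀.2.2.2] at hw₂
        exact hGD κ.p κ.q κ.p' κ.q' (S κ.n) (T κ.n') κ.l₁ κ.l₂ B hST hw₁ hw₂ hpq hqp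
      rw [hcyl, ← setIntegral_cyl_midCurve_law κ _ _ hGDκ f, ← integral_sub Integrable.of_finite
        Integrable.of_finite]
      have hb := norm_setIntegral_le_of_norm_le_const (μ := P) (s := κ.cyl (S κ.n) (T κ.n') Ω δ a b)
        (f := fun γ => f γ.curve - f (κ.midCurve δ γ)) (C := K * C) (measure_lt_top _ _) ?_
      · rwa [Real.norm_eq_abs] at hb
      · intro γ hγ
        rw [Real.norm_eq_abs, ← Real.dist_eq]
        exact (hf.dist_le_mul _ _).trans
          (mul_le_mul_of_nonneg_left (dist_curve_midCurve_le_N hC (hcs γ₀) hγ₀ hγ) K.2)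
    · have h0 : Cell κ = ∅ := Set.not_nonempty_iff_eq_empty.1 hne
      simp [h0]
  -- bad cells
  set bad : GateLabel → Prop := fun κ => ε < |J κ - νf| with hbad
  have hbadle : ∀ κ, |J κ - νf| ≤ ε + 2 * ‖f‖ * (if bad κ then 1 else 0) := by
    intro κ
    by_cases h : bad κ
    · rw [if_pos h, mul_one]
      calc |J κ - νf| ≤ |J κ| + |νf| := abs_sub _ _
        _ ≤ ‖f‖ + ‖f‖ := add_le_add (hJ_le κ) hνf_le
        _ ≤ ε + 2 * ‖f‖ := by linarith
    · rw [if_neg h, mul_zero, add_zero]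
      exact not_lt.1 h
  have hbadU : P.real (⋃ κ ∈ Λ.filter bad, Cell κ) ≤ ε := by
    refine (measureReal_mono ?_).trans hCTS
    intro γ hγ
    simp only [Set.mem_iUnion, exists_prop, Finset.mem_filter] at hγ
    obtain ⟨κ, ⟨-, hκ⟩, hγκ⟩ := hγ
    exact ⟨κ.n, κ.m, κ.p, κ.q, κ.n', κ.m', κ.p', κ.q', hγκ.1, hγκ.2.1, hκ⟩
  have hbadsum : ∑ κ ∈ Λ, P.real (Cell κ) * (if bad κ then (1 : ℝ) else 0) ≤ ε := by
    rw [← Finset.sum_filter_add_sum_filter_not Λ bad]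
    have h1 : ∑ κ ∈ Λ.filter bad, P.real (Cell κ) * (if bad κ then (1 : ℝ) else 0) =
        ∑ κ ∈ Λ.filter bad, P.real (Cell κ) :=
      Finset.sum_congr rfl fun κ hκ => by rw [if_pos (Finset.mem_filter.1 hκ).2, mul_one]
    have h2 : ∑ κ ∈ Λ.filter (fun κ => ¬ bad κ), P.real (Cell κ) * (if bad κ then (1 : ℝ) else 0) = 0 :=
      Finset.sum_eq_zero fun κ hκ => by rw [if_neg (Finset.mem_filter.1 hκ).2, mul_zero]
    rw [h1, h2, add_zero, ← measureReal_biUnion_finset (fun κ hκ κ' hκ' h =>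
      hdisj (Finset.mem_filter.1 hκ).1 (Finset.mem_filter.1 hκ').1 h) (fun κ _ => hmeas _)]
    exact hbadU
  -- decomposition of the integral and of the mass
  have hint : Integrable (fun γ : HexDomainSAW Ω δ a b => f γ.curve) P := Integrable.of_finite
  have hsplit : ∫ γ, f γ.curve ∂P = ∑ κ ∈ Λ, ∫ γ in Cell κ, f γ.curve ∂P + ∫ γ in Gᶜ, f γ.curve ∂P := by
    rw [← integral_add_compl (hmeas G) hint, hGU,
      integral_biUnion_finset Λ (fun κ _ => hmeas _) hdisj (fun κ _ => hint.integrableOn)]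
  have hmass : ∑ κ ∈ Λ, P.real (Cell κ) + P.real Gᶜ = 1 := by
    rw [← measureReal_biUnion_finset hdisj (fun κ _ => hmeas _), ← hGU,
      measureReal_add_measureReal_compl (hmeas G), probReal_univ]
  have hGc : P.real Gᶜ ≤ ε := by
    refine le_trans (le_of_eq ?_) hRA
    rfl
  have hsumG : ∑ κ ∈ Λ, P.real (Cell κ) ≤ 1 := by
    have : 0 ≤ P.real Gᶜ := measureReal_nonneg
    linarith
  -- the complement term
  have hcompl : |∫ γ in Gᶜ, f γ.curve ∂P - P.real Gᶜ * νf| ≤ 2 * ‖f‖ * P.real Gᶜ := by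
    rw [← smul_eq_mul, ← setIntegral_const νf, ← integral_sub Integrable.of_finite
      Integrable.of_finite]
    have hb := norm_setIntegral_le_of_norm_le_const (μ := P) (s := Gᶜ)
      (f := fun γ : HexDomainSAW Ω δ a b => f γ.curve - νf) (C := 2 * ‖f‖) (measure_lt_top _ _) ?_
    · rwa [Real.norm_eq_abs] at hb
    · intro γ _
      rw [Real.norm_eq_abs]
      calc |f γ.curve - νf| ≤ |f γ.curve| + |νf| := abs_sub _ _
        _ ≤ ‖f‖ + ‖f‖ := add_le_add (by rw [← Real.norm_eq_abs]; exact f.norm_coe_le_norm _) hνf_le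
        _ = 2 * ‖f‖ := by ring
  -- assemble
  have key : ∫ γ, f γ.curve ∂P - νf =
      ∑ κ ∈ Λ, (∫ γ in Cell κ, f γ.curve ∂P - P.real (Cell κ) * J κ) +
      ∑ κ ∈ Λ, P.real (Cell κ) * (J κ - νf) +
      (∫ γ in Gᶜ, f γ.curve ∂P - P.real Gᶜ * νf) := by
    rw [hsplit]
    conv_lhs => rw [show νf = (∑ κ ∈ Λ, P.real (Cell κ) + P.real Gᶜ) * νf by rw [hmass, one_mul]]
    rw [add_mul, Finset.sum_mul]
    simp only [Finset.sum_sub_distrib, mul_sub]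
    ring
  rw [key]
  have h1 : |∑ κ ∈ Λ, (∫ γ in Cell κ, f γ.curve ∂P - P.real (Cell κ) * J κ)| ≤ K * C := by
    refine (Finset.abs_sum_le_sum_abs _ _).trans ?_
    refine (Finset.sum_le_sum fun κ _ => hper κ).trans ?_
    rw [← Finset.mul_sum]
    calc (K : ℝ) * C * ∑ κ ∈ Λ, P.real (Cell κ) ≤ K * C * 1 :=
          mul_le_mul_of_nonneg_left hsumG (mul_nonneg K.2 hC)
      _ = K * C := mul_one _
  have h2 : |∑ κ ∈ Λ, P.real (Cell κ) * (J κ - νf)| ≤ ε + 2 * ‖f‖ * ε := by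
    refine (Finset.abs_sum_le_sum_abs _ _).trans ?_
    have h2a : ∀ κ ∈ Λ, |P.real (Cell κ) * (J κ - νf)| ≤
        P.real (Cell κ) * ε + 2 * ‖f‖ * (P.real (Cell κ) * (if bad κ then (1 : ℝ) else 0)) := by
      intro κ _
      rw [abs_mul, abs_of_nonneg measureReal_nonneg]
      have := mul_le_mul_of_nonneg_left (hbadle κ) (measureReal_nonneg (μ := P) (s := Cell κ))
      linarith
    refine (Finset.sum_le_sum h2a).trans ?_
    rw [Finset.sum_add_distrib, ← Finset.sum_mul, ← Finset.mul_sum]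
    have hf0 : 0 ≤ 2 * ‖f‖ := by positivity
    nlinarith [hsumG, hbadsum, mul_le_mul_of_nonneg_left hbadsum hf0,
      mul_le_mul_of_nonneg_right hsumG hε]
  have h3 : |∫ γ in Gᶜ, f γ.curve ∂P - P.real Gᶜ * νf| ≤ 2 * ‖f‖ * ε :=
    hcompl.trans (mul_le_mul_of_nonneg_left hGc (by positivity))
  calc |_| ≤ |∑ κ ∈ Λ, (∫ γ in Cell κ, f γ.curve ∂P - P.real (Cell κ) * J κ)| +
        |∑ κ ∈ Λ, P.real (Cell κ) * (J κ - νf)| +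
        |∫ γ in Gᶜ, f γ.curve ∂P - P.real Gᶜ * νf| := abs_add_three _ _ _
    _ ≤ K * C + (ε + 2 * ‖f‖ * ε) + 2 * ‖f‖ * ε := add_le_add (add_le_add h1 h2) h3
    _ = K * C + ε * (1 + 4 * ‖f‖) := by ring

end PerMesh

end Summit.CriticalPhenomena.SAWScalingLimit.Theorems.ObservableToSLER.NestedGate

namespace Summit.CriticalPhenomena.SAWScalingLimit.Theorems.ObservableToSLER.NestedGate

open Literature.Probability.LatticeModels (HexVertex hexGraph hexCenter triZeta Site)
open Literature.Probability.RandomPlanarGeometry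
open Literature.Probability.RandomPlanarGeometry.SAW
open Summit.CriticalPhenomena.SAWScalingLimit.Theorems.ObservableToSLER.BridgeGate

/-- **Registered sub-goal `stub_perMeshEstimateN`** (self-contained form of `abs_integral_sub_le_of_productCellN`). -/
theorem stub_perMeshEstimateN : ∀ (Ω : Set ℂ) (δ ρ R C : ℝ) (S T : ℕ → Set HexVertex) (a b : HexVertex) (ν : Measure (CurveClass ℂ)) (f : CurveClass ℂ →ᵇ ℝ) (K : ℝ≥0) (ε : ℝ) [IsProbabilityMeasure (hexSAWLaw Ω δ a b)] [IsProbabilityMeasure ν], Bornology.IsBounded Ω → 0 < δ → 0 ≤ C → (∀ (p q p' q' : HexVertex) (S T : Set HexVertex) (l₁ l₂ : List HexVertex) (B : Set (List HexVertex)), Disjoint S T → (∃ w₁ : (hexDomainGraph Ω δ).Walk a p, w₁.IsPath ∧ w₁.support = l₁ ∧ ∀ v ∈ l₁, v ∈ S) → (∃ w₂ : (hexDomainGraph Ω δ).Walk p' b, w₂.IsPath ∧ w₂.support = l₂ ∧ ∀ v ∈ l₂, v ∈ T) → (hexDomainGraph Ω δ).Adj p q → (hexDomainGraph Ω δ).Adj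 q' p' → hexSAWWeight Ω δ a b {γ | ∃ mid ∈ B, mid.head? = some q ∧ mid.getLast? = some q' ∧ (∀ v ∈ mid, v ∉ S ∧ v ∉ T) ∧ γ.walk.support = l₁ ++ mid ++ l₂} = ENNReal.ofReal (hexCriticalFugacity ^ (l₁.length + l₂.length)) * hexSAWWeight Ω δ q q' {γ | γ.walk.support ∈ B ∧ ∀ v ∈ γ.walk.support, v ∉ S ∧ v ∉ T}) → (∀ γ₀ : HexDomainSAW Ω δ a b, γ₀ ∈ productCellN Ω δ ρ R S T a b C) → LipschitzWith K f → 0 ≤ ε → (hexSAWLaw Ω δ a b).real {γ | ¬ (GoodRenewalAtN Ω δ ρ R S a γ.walk.support ∧ GoodRenewalAtN Ω δ ρ R T b γ.walk.support.reverse)} ≤ ε → (hexSAWLaw Ω δ a b).real {γ | ∃ (n m : ℕ) (p q : HexVertex) (n' m' : ℕ) (p' q' : HexVertex), IsFirstGoodGateN Ω δ ρ R S a γ.walk.support n m p q ∧ IsFirstGoodGateN Ω δ ρ R T b γ.walk.support.reverse n' m' p' q' ∧ ε < |(∫ ξ, f ξ.curve ∂(carvedLaw Ω δ (S n ∪ T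 n') q q')) - ∫ x, f x ∂ν|} ≤ ε → |∫ γ, f γ.curve ∂(hexSAWLaw Ω δ a b) - ∫ x, f x ∂ν| ≤ K * C + ε * (1 + 4 * ‖f‖) :=
  fun _ _ _ _ _ _ _ _ _ ν f _ _ _ _ hΩ hδ hC hGD hcs hf hε hRA hCTS =>
    abs_integral_sub_le_of_productCellN hΩ hδ hC hGD hcs ν f hf hε hRA hCTS

end Summit.CriticalPhenomena.SAWScalingLimit.Theorems.ObservableToSLER.NestedGate

end
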